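import Mathlib

/-!
# Archimedean Newton-polygon windows of a real fewnomial: dominance regions are zero-free, transition windows are monotone

HONEST FRAMING.  Helper file (part 1 of 2) toward the lifting crux `WeakLifting` (stmt-ValiantsHypothesis-19561; aside
`Lifting` stmt-ValiantsHypothesis-19772) of route `KPlusLogSqLaw` (cell `pub-symmetroid`, seat val-sym-lift-p2 g3, 2026-08-26).
Elementary real analysis about ONE real polynomial `f = Σ_s a_s X^s`; nothing here asserts `WeakLifting`, `TropicalB`,
Conjecture B, `MatrixDescartes` (stmt-ValiantsHypothesis-18050) or anything about VP ≠ VNP.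

CONTENT (the two mechanisms behind an EXACT archimedean root count, see part 2 `…LiftingExactPatchwork`):
* ARCHIMEDEAN DOMINANCE `Σ_{s ≠ w} |a_s| x^s < |a_w| x^w` at a point `x > 0` decides the sign of `f(x)`
  (`mul_eval_pos_of_dominant`), and dominance TRANSPORTS: from two points `p ≤ q` to `[p, q]` because
  `x ↦ Σ_{s ≠ w} |a_s| x^{s − w}` is convex on `(0, ∞)` (integer powers, `convexOn_zpow`) — `sum_mul_pow_lt_of_endpoints` — and
  from one point downwards / upwards when `w` is the least / largest exponent (`sum_mul_pow_lt_of_le_of_forall_le`,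
  `sum_mul_pow_lt_of_ge_of_forall_ge`).  So a dominance REGION is certified by its two endpoints and is zero-free.
* TRANSITION WINDOWS.  For an edge `(u, w)`, `u < w`, the MARGIN inequality
  `Σ_{s ∉ {u,w}} |s − u| |a_s| x^s < (w − u) |a_w| x^w` at the two endpoints of `[p, q]` makes `a_w · f(x) / x^u` strictly
  increasing on `[p, q]` (`strictMonoOn_window`: derivative `= a_w x^{−u−1} Σ_s a_s (s − u) x^s`, positive by the margin,
  transported inside by the same convexity); hence at most ONE zero of `f` in the window (`eq_of_isRoot_of_mem_window`), NONE if
  the edge does not alternate (`eval_ne_zero_of_mem_window_of_pos`), and (IVT) at least one if it does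
  (`exists_root_of_alternating_window`).
No `def`; statements are spelled with `Finset` sums over `f.support` so that certificates are finitely many inequalities.
[folklore] (Newton-polygon / patchworking asymptotics made quantitative; cf. Viro's method in dimension one).
-/

set_option linter.dupNamespace false
set_option autoImplicit false

namespace Summit.ValiantsHypothesis.ValiantsHypothesis.Theorems.KPlusLogSqLaw.ExactPatchwork

open Polynomial Finset
open scoped BigOperators

/-- `f(x) = a_w x^w + Σ_{s ∈ supp f, s ≠ w} a_s x^s`. [folklore] -/
theorem eval_eq_coeff_mul_pow_add (f : ℝ[X]) {w : ℕ} (hw : w ∈ f.support) (x : ℝ) :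
    f.eval x = f.coeff w * x ^ w + ∑ s ∈ f.support.erase w, f.coeff s * x ^ s := by
  rw [Polynomial.eval_eq_sum, Polynomial.sum_def, ← Finset.add_sum_erase _ _ hw]

/-- the tail estimate `|f(x) − a_w x^w| ≤ Σ_{s ≠ w} |a_s| x^s` for `x ≥ 0`. [folklore] -/
theorem abs_eval_sub_le (f : ℝ[X]) {w : ℕ} (hw : w ∈ f.support) {x : ℝ} (hx : 0 ≤ x) :
    |f.eval x - f.coeff w * x ^ w| ≤ ∑ s ∈ f.support.erase w, |f.coeff s| * x ^ s := by
  rw [eval_eq_coeff_mul_pow_add f hw x, add_sub_cancel_left]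
  refine (Finset.abs_sum_le_sum_abs _ _).trans (le_of_eq (Finset.sum_congr rfl fun s _ => ?_))
  rw [abs_mul, abs_of_nonneg (pow_nonneg hx s)]

/-- **Archimedean dominance decides the sign.** If `Σ_{s ≠ w} |a_s| x^s < |a_w| x^w` at some `x > 0`, then
`a_w · f(x) > 0`; in particular `f(x) ≠ 0`. [folklore] -/
theorem mul_eval_pos_of_dominant (f : ℝ[X]) {w : ℕ} {x : ℝ} (hx : 0 < x)
    (hD : ∑ s ∈ f.support.erase w, |f.coeff s| * x ^ s < |f.coeff w| * x ^ w) :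
    0 < f.coeff w * f.eval x := by
  have hw0 : f.coeff w ≠ 0 := by
    intro h
    rw [h, abs_zero, zero_mul] at hD
    exact absurd hD (not_lt.mpr (Finset.sum_nonneg fun s _ => mul_nonneg (abs_nonneg _) (pow_nonneg hx.le s)))
  have hw : w ∈ f.support := Polynomial.mem_support_iff.mpr hw0
  have h1 := abs_eval_sub_le f hw hx.le
  have h2 : |f.eval x - f.coeff w * x ^ w| < |f.coeff w| * x ^ w := lt_of_le_of_lt h1 hD
  have hxw : 0 < x ^ w := pow_pos hx w
  -- `a_w f(x) = a_w² x^w + a_w (f(x) − a_w x^w) ≥ a_w² x^w − |a_w| |f(x) − a_w x^w| > 0`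
  have h3 : |f.coeff w * (f.eval x - f.coeff w * x ^ w)| < f.coeff w * f.coeff w * x ^ w := by
    rw [abs_mul]
    calc |f.coeff w| * |f.eval x - f.coeff w * x ^ w| < |f.coeff w| * (|f.coeff w| * x ^ w) :=
          mul_lt_mul_of_pos_left h2 (abs_pos.mpr hw0)
      _ = f.coeff w * f.coeff w * x ^ w := by rw [← mul_assoc, abs_mul_abs_self]
  have h4 := neg_abs_le (f.coeff w * (f.eval x - f.coeff w * x ^ w))
  have h5 : f.coeff w * f.eval x = f.coeff w * f.coeff w * x ^ w + f.coeff w * (f.eval x - f.coeff w * x ^ w) := by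
    ring
  rw [h5]
  linarith

/-- A finite sum of nonnegative multiples of integer powers is convex on `(0, ∞)`. [folklore] -/
theorem convexOn_sum_mul_zpow (S : Finset ℕ) (c : ℕ → ℝ) (hc : ∀ s, 0 ≤ c s) (w : ℤ) :
    ConvexOn ℝ (Set.Ioi (0 : ℝ)) (fun y : ℝ => ∑ s ∈ S, c s * y ^ ((s : ℤ) - w)) := by
  classical
  induction S using Finset.induction_on with
  | empty =>
    simp only [Finset.sum_empty]
    exact convexOn_const 0 (convex_Ioi 0)
  | insert a S ha ih =>
    simp only [Finset.sum_insert ha]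
    exact ConvexOn.add (by simpa using (convexOn_zpow ((a : ℤ) - w)).smul (hc a)) ih

/-- rescaling identity: for `y > 0`, `Σ c_s y^s = y^w · Σ c_s y^(s − w)` (integer exponent). [folklore] -/
theorem sum_mul_pow_eq_pow_mul_sum_zpow (S : Finset ℕ) (c : ℕ → ℝ) (w : ℕ) {y : ℝ} (hy : 0 < y) :
    ∑ s ∈ S, c s * y ^ s = y ^ w * ∑ s ∈ S, c s * y ^ ((s : ℤ) - w) := by
  rw [Finset.mul_sum]
  refine Finset.sum_congr rfl fun s _ => ?_
  have : y ^ ((s : ℤ) - w) = y ^ s / y ^ w := by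
    rw [zpow_sub₀ hy.ne', zpow_natCast, zpow_natCast]
  rw [this]
  field_simp

/-- **Convexity transport.** A strict dominance inequality `Σ_{s∈S} c_s x^s < A x^w` with `c ≥ 0` that holds at two points
`0 < p ≤ q` holds on the whole interval `[p, q]` (the ratio is a convex function of `x` on `(0,∞)`). [folklore] -/
theorem sum_mul_pow_lt_of_endpoints (S : Finset ℕ) (c : ℕ → ℝ) (hc : ∀ s, 0 ≤ c s) (w : ℕ) {A p q x : ℝ}
    (hp : 0 < p) (hpx : p ≤ x) (hxq : x ≤ q)
    (h1 : ∑ s ∈ S, c s * p ^ s < A * p ^ w) (h2 : ∑ s ∈ S, c s * q ^ s < A * q ^ w) :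
    ∑ s ∈ S, c s * x ^ s < A * x ^ w := by
  have hx : 0 < x := lt_of_lt_of_le hp hpx
  have hq : 0 < q := lt_of_lt_of_le hx hxq
  set g : ℝ → ℝ := fun y => ∑ s ∈ S, c s * y ^ ((s : ℤ) - w) with hg
  have key : ∀ {y : ℝ}, 0 < y → (∑ s ∈ S, c s * y ^ s < A * y ^ w ↔ g y < A) := by
    intro y hy
    rw [sum_mul_pow_eq_pow_mul_sum_zpow S c w hy, mul_comm A]
    have hyw : 0 < y ^ w := pow_pos hy w
    constructor
    · intro h; exact lt_of_mul_lt_mul_left h hyw.le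
    · intro h; exact mul_lt_mul_of_pos_left h hyw
  rw [key hx]
  have hconv := convexOn_sum_mul_zpow S c hc (w : ℤ)
  have hseg : x ∈ segment ℝ p q := by
    rw [segment_eq_Icc (hpx.trans hxq)]; exact ⟨hpx, hxq⟩
  have hle : g x ≤ max (g p) (g q) := hconv.le_on_segment hp hq hseg
  exact lt_of_le_of_lt hle (max_lt ((key hp).mp h1) ((key hq).mp h2))

/-- **Monotone transport below.** If every exponent of `S` is `≥ w`, a dominance `Σ c_s p^s < A p^w` at `p` persists on
`(0, p]`. [folklore] -/
theorem sum_mul_pow_lt_of_le_of_forall_le (S : Finset ℕ) (c : ℕ → ℝ) (hc : ∀ s, 0 ≤ c s) (w : ℕ)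
    (hS : ∀ s ∈ S, w ≤ s) {A p x : ℝ} (hx : 0 < x) (hxp : x ≤ p)
    (h1 : ∑ s ∈ S, c s * p ^ s < A * p ^ w) : ∑ s ∈ S, c s * x ^ s < A * x ^ w := by
  have hp : 0 < p := lt_of_lt_of_le hx hxp
  -- `p^w · Σ c_s x^s ≤ x^w · Σ c_s p^s`
  have hterm : ∀ s ∈ S, c s * x ^ s * p ^ w ≤ c s * p ^ s * x ^ w := by
    intro s hs
    obtain ⟨e, he⟩ := Nat.exists_eq_add_of_le (hS s hs)
    have hxs : x ^ s = x ^ w * x ^ e := by rw [he, pow_add]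
    have hps : p ^ s = p ^ w * p ^ e := by rw [he, pow_add]
    rw [hxs, hps]
    have : x ^ e ≤ p ^ e := pow_le_pow_left₀ hx.le hxp e
    calc c s * (x ^ w * x ^ e) * p ^ w = c s * (x ^ w * p ^ w) * x ^ e := by ring
      _ ≤ c s * (x ^ w * p ^ w) * p ^ e :=
          mul_le_mul_of_nonneg_left this (mul_nonneg (hc s) (by positivity))
      _ = c s * (p ^ w * p ^ e) * x ^ w := by ring
  have hsum : (∑ s ∈ S, c s * x ^ s) * p ^ w ≤ (∑ s ∈ S, c s * p ^ s) * x ^ w := by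
    rw [Finset.sum_mul, Finset.sum_mul]; exact Finset.sum_le_sum hterm
  have h2 : (∑ s ∈ S, c s * p ^ s) * x ^ w < A * p ^ w * x ^ w :=
    mul_lt_mul_of_pos_right h1 (pow_pos hx w)
  have h3 : (∑ s ∈ S, c s * x ^ s) * p ^ w < (A * x ^ w) * p ^ w := by nlinarith
  exact lt_of_mul_lt_mul_right h3 (pow_nonneg hp.le w)

/-- **Monotone transport above.** If every exponent of `S` is `≤ w`, a dominance at `q` persists on `[q, ∞)`. [folklore] -/
theorem sum_mul_pow_lt_of_ge_of_forall_ge (S : Finset ℕ) (c : ℕ → ℝ) (hc : ∀ s, 0 ≤ c s) (w : ℕ)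
    (hS : ∀ s ∈ S, s ≤ w) {A q x : ℝ} (hq : 0 < q) (hqx : q ≤ x)
    (h1 : ∑ s ∈ S, c s * q ^ s < A * q ^ w) : ∑ s ∈ S, c s * x ^ s < A * x ^ w := by
  have hx : 0 < x := lt_of_lt_of_le hq hqx
  have hterm : ∀ s ∈ S, c s * x ^ s * q ^ w ≤ c s * q ^ s * x ^ w := by
    intro s hs
    obtain ⟨e, he⟩ := Nat.exists_eq_add_of_le (hS s hs)
    rw [he]
    have : q ^ e ≤ x ^ e := pow_le_pow_left₀ hq.le hqx e
    calc c s * x ^ s * q ^ (s + e) = c s * (x ^ s * q ^ s) * q ^ e := by rw [pow_add]; ring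
      _ ≤ c s * (x ^ s * q ^ s) * x ^ e :=
          mul_le_mul_of_nonneg_left this (mul_nonneg (hc s) (by positivity))
      _ = c s * q ^ s * x ^ (s + e) := by rw [pow_add]; ring
  have hsum : (∑ s ∈ S, c s * x ^ s) * q ^ w ≤ (∑ s ∈ S, c s * q ^ s) * x ^ w := by
    rw [Finset.sum_mul, Finset.sum_mul]; exact Finset.sum_le_sum hterm
  have h2 : (∑ s ∈ S, c s * q ^ s) * x ^ w < A * q ^ w * x ^ w :=
    mul_lt_mul_of_pos_right h1 (pow_pos hx w)
  have h3 : (∑ s ∈ S, c s * x ^ s) * q ^ w < (A * x ^ w) * q ^ w := by nlinarith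
  exact lt_of_mul_lt_mul_right h3 (pow_nonneg hq.le w)


/-! ## The transition window: after division by `x^u` the fewnomial is strictly monotone -/

/-- `f(y) = y^u · Σ_{s ∈ supp f} a_s y^(s − u)` for `y > 0` (integer exponents). [folklore] -/
theorem eval_eq_pow_mul_sum_zpow (f : ℝ[X]) (u : ℕ) {y : ℝ} (hy : 0 < y) :
    f.eval y = y ^ u * ∑ s ∈ f.support, f.coeff s * y ^ ((s : ℤ) - u) := by
  rw [Polynomial.eval_eq_sum, Polynomial.sum_def]
  exact sum_mul_pow_eq_pow_mul_sum_zpow f.support (fun s => f.coeff s) u hy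

/-- derivative of `y ↦ Σ a_s y^(s−u)` at `y ≠ 0`, written as `y^(−u−1) · Σ a_s (s − u) y^s`. [folklore] -/
theorem hasDerivAt_sum_zpow (f : ℝ[X]) (u : ℕ) {y : ℝ} (hy : y ≠ 0) :
    HasDerivAt (fun z : ℝ => ∑ s ∈ f.support, f.coeff s * z ^ ((s : ℤ) - u))
      (y ^ (-(u : ℤ) - 1) * ∑ s ∈ f.support, f.coeff s * (((s : ℝ) - u) * y ^ s)) y := by
  have h : HasDerivAt (fun z : ℝ => ∑ s ∈ f.support, f.coeff s * z ^ ((s : ℤ) - u))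
      (∑ s ∈ f.support, f.coeff s * ((((s : ℤ) - u : ℤ) : ℝ) * y ^ ((s : ℤ) - u - 1))) y := by
    apply HasDerivAt.fun_sum
    intro s _
    exact (hasDerivAt_zpow ((s : ℤ) - u) y (Or.inl hy)).const_mul (f.coeff s)
  refine h.congr_deriv ?_
  rw [Finset.mul_sum]
  refine Finset.sum_congr rfl fun s _ => ?_
  have h1 : y ^ ((s : ℤ) - u - 1) = y ^ s * y ^ (-(u : ℤ) - 1) := by
    rw [show ((s : ℤ) - u - 1) = (s : ℤ) + (-(u : ℤ) - 1) by ring, zpow_add₀ hy, zpow_natCast]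
  rw [h1]
  push_cast
  ring

/-- **Derivative sign from the margin.** If at `y > 0` the `w`-term beats the `(s − u)`-weighted sum of the other
non-`u` terms, `Σ_{s ∉ {u,w}} |s − u| |a_s| y^s < (w − u) |a_w| y^w`, then `a_w · Σ_s a_s (s − u) y^s > 0`. [folklore] -/
theorem mul_weightedSum_pos_of_margin (f : ℝ[X]) {u w : ℕ} (huw : u < w) (hw : w ∈ f.support) {y : ℝ} (hy : 0 < y)
    (hM : ∑ s ∈ (f.support.erase u).erase w, |(s : ℝ) - u| * |f.coeff s| * y ^ s
      < ((w : ℝ) - u) * |f.coeff w| * y ^ w) :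
    0 < f.coeff w * ∑ s ∈ f.support, f.coeff s * (((s : ℝ) - u) * y ^ s) := by
  classical
  -- split off the `w`-term and the (vanishing) `u`-term
  have hsplit : ∑ s ∈ f.support, f.coeff s * (((s : ℝ) - u) * y ^ s)
      = f.coeff w * (((w : ℝ) - u) * y ^ w) + ∑ s ∈ (f.support.erase u).erase w, f.coeff s * (((s : ℝ) - u) * y ^ s) := by
    have hw' : w ∈ f.support.erase u := Finset.mem_erase.mpr ⟨(ne_of_lt huw).symm, hw⟩
    by_cases hu : u ∈ f.support
    · rw [← Finset.add_sum_erase _ _ hu, ← Finset.add_sum_erase _ _ hw']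
      simp
    · have : f.support.erase u = f.support := Finset.erase_eq_of_notMem hu
      rw [this, ← Finset.add_sum_erase _ _ hw]
  rw [hsplit]
  have hR : |∑ s ∈ (f.support.erase u).erase w, f.coeff s * (((s : ℝ) - u) * y ^ s)|
      ≤ ∑ s ∈ (f.support.erase u).erase w, |(s : ℝ) - u| * |f.coeff s| * y ^ s := by
    refine (Finset.abs_sum_le_sum_abs _ _).trans (le_of_eq (Finset.sum_congr rfl fun s _ => ?_))
    rw [abs_mul, abs_mul, abs_of_nonneg (pow_nonneg hy.le s)]; ring
  have hw0 : f.coeff w ≠ 0 := Polynomial.mem_support_iff.mp hw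
  have hwu : (0 : ℝ) < (w : ℝ) - u := by
    have : (u : ℝ) < w := by exact_mod_cast huw
    linarith
  set R := ∑ s ∈ (f.support.erase u).erase w, f.coeff s * (((s : ℝ) - u) * y ^ s) with hRdef
  have h1 : |f.coeff w * R| < f.coeff w * f.coeff w * (((w : ℝ) - u) * y ^ w) := by
    rw [abs_mul]
    calc |f.coeff w| * |R| ≤ |f.coeff w| * ∑ s ∈ (f.support.erase u).erase w, |(s : ℝ) - u| * |f.coeff s| * y ^ s :=
          mul_le_mul_of_nonneg_left hR (abs_nonneg _)
      _ < |f.coeff w| * (((w : ℝ) - u) * |f.coeff w| * y ^ w) := mul_lt_mul_of_pos_left hM (abs_pos.mpr hw0)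
      _ = f.coeff w * f.coeff w * (((w : ℝ) - u) * y ^ w) := by
          rw [show |f.coeff w| * (((w : ℝ) - u) * |f.coeff w| * y ^ w) = (|f.coeff w| * |f.coeff w|) * (((w : ℝ) - u) * y ^ w)
            by ring, abs_mul_abs_self]
  have h2 := neg_abs_le (f.coeff w * R)
  have h3 : f.coeff w * (f.coeff w * (((w : ℝ) - u) * y ^ w) + R)
      = f.coeff w * f.coeff w * (((w : ℝ) - u) * y ^ w) + f.coeff w * R := by ring
  rw [h3]
  linarith

/-- **Window monotonicity.** On `[p, q] ⊂ (0,∞)`, if the margin inequality for the edge `(u, w)` holds at both endpoints,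
then `y ↦ a_w · Σ_s a_s y^(s−u)` (= `a_w · f(y) / y^u`) is strictly increasing on `[p, q]`. [folklore] -/
theorem strictMonoOn_window (f : ℝ[X]) {u w : ℕ} (huw : u < w) (hw : w ∈ f.support) {p q : ℝ} (hp : 0 < p)
    (hMp : ∑ s ∈ (f.support.erase u).erase w, |(s : ℝ) - u| * |f.coeff s| * p ^ s < ((w : ℝ) - u) * |f.coeff w| * p ^ w)
    (hMq : ∑ s ∈ (f.support.erase u).erase w, |(s : ℝ) - u| * |f.coeff s| * q ^ s < ((w : ℝ) - u) * |f.coeff w| * q ^ w) :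
    StrictMonoOn (fun y : ℝ => f.coeff w * ∑ s ∈ f.support, f.coeff s * y ^ ((s : ℤ) - u)) (Set.Icc p q) := by
  have hderiv : ∀ y, 0 < y → HasDerivAt (fun z : ℝ => f.coeff w * ∑ s ∈ f.support, f.coeff s * z ^ ((s : ℤ) - u))
      (f.coeff w * (y ^ (-(u : ℤ) - 1) * ∑ s ∈ f.support, f.coeff s * (((s : ℝ) - u) * y ^ s))) y :=
    fun y hy => (hasDerivAt_sum_zpow f u hy.ne').const_mul (f.coeff w)
  refine strictMonoOn_of_deriv_pos (convex_Icc p q) ?_ ?_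
  · intro y hy
    exact (hderiv y (lt_of_lt_of_le hp hy.1)).continuousAt.continuousWithinAt
  · intro y hy
    rw [interior_Icc] at hy
    have hy0 : 0 < y := lt_trans hp hy.1
    rw [(hderiv y hy0).deriv]
    -- margin at `y` by convexity transport from the endpoints
    have hMy : ∑ s ∈ (f.support.erase u).erase w, |(s : ℝ) - u| * |f.coeff s| * y ^ s
        < ((w : ℝ) - u) * |f.coeff w| * y ^ w := by
      have := sum_mul_pow_lt_of_endpoints ((f.support.erase u).erase w) (fun s => |(s : ℝ) - u| * |f.coeff s|)
        (fun s => mul_nonneg (abs_nonneg _) (abs_nonneg _)) w (A := ((w : ℝ) - u) * |f.coeff w|) hp hy.1.le hy.2.le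
        hMp hMq
      exact this
    have hpos := mul_weightedSum_pos_of_margin f huw hw hy0 hMy
    have ht : 0 < y ^ (-(u : ℤ) - 1) := zpow_pos hy0 _
    rw [mul_left_comm]
    exact mul_pos ht hpos

/-- **At most one zero per window.** Under the hypotheses of `strictMonoOn_window`, two zeros of `f` in `[p, q]`
coincide. [folklore] -/
theorem eq_of_isRoot_of_mem_window (f : ℝ[X]) {u w : ℕ} (huw : u < w) (hw : w ∈ f.support) {p q : ℝ} (hp : 0 < p)
    (hMp : ∑ s ∈ (f.support.erase u).erase w, |(s : ℝ) - u| * |f.coeff s| * p ^ s < ((w : ℝ) - u) * |f.coeff w| * p ^ w)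
    (hMq : ∑ s ∈ (f.support.erase u).erase w, |(s : ℝ) - u| * |f.coeff s| * q ^ s < ((w : ℝ) - u) * |f.coeff w| * q ^ w)
    {y₁ y₂ : ℝ} (h₁ : y₁ ∈ Set.Icc p q) (h₂ : y₂ ∈ Set.Icc p q) (hr₁ : f.eval y₁ = 0) (hr₂ : f.eval y₂ = 0) :
    y₁ = y₂ := by
  have hmono := strictMonoOn_window f huw hw hp hMp hMq
  have key : ∀ {y : ℝ}, y ∈ Set.Icc p q → f.eval y = 0 →
      f.coeff w * ∑ s ∈ f.support, f.coeff s * y ^ ((s : ℤ) - u) = 0 := by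
    intro y hy hr
    have hy0 : 0 < y := lt_of_lt_of_le hp hy.1
    rw [eval_eq_pow_mul_sum_zpow f u hy0] at hr
    rcases mul_eq_zero.mp hr with h | h
    · exact absurd h (pow_ne_zero _ hy0.ne')
    · rw [h, mul_zero]
  exact hmono.injOn h₁ h₂ ((key h₁ hr₁).trans (key h₂ hr₂).symm)

/-- **A non-alternating window has no zero.** If moreover `u` dominates at `p`, `w` dominates at `q` and `a_u a_w > 0`,
then `f` has no zero in `[p, q]`. [folklore] -/
theorem eval_ne_zero_of_mem_window_of_pos (f : ℝ[X]) {u w : ℕ} (huw : u < w) (hw : w ∈ f.support) {p q : ℝ}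
    (hp : 0 < p) (hpq : p ≤ q)
    (hDp : ∑ s ∈ f.support.erase u, |f.coeff s| * p ^ s < |f.coeff u| * p ^ u)
    (hMp : ∑ s ∈ (f.support.erase u).erase w, |(s : ℝ) - u| * |f.coeff s| * p ^ s < ((w : ℝ) - u) * |f.coeff w| * p ^ w)
    (hMq : ∑ s ∈ (f.support.erase u).erase w, |(s : ℝ) - u| * |f.coeff s| * q ^ s < ((w : ℝ) - u) * |f.coeff w| * q ^ w)
    (hsign : 0 < f.coeff u * f.coeff w) {y : ℝ} (hy : y ∈ Set.Icc p q) : f.eval y ≠ 0 := by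
  have hmono := strictMonoOn_window f huw hw hp hMp hMq
  set ψ : ℝ → ℝ := fun z => f.coeff w * ∑ s ∈ f.support, f.coeff s * z ^ ((s : ℤ) - u) with hψ
  -- `ψ(p) > 0`: `f(p)` has the sign of `a_u`, which is the sign of `a_w`
  have hfp : 0 < f.coeff u * f.eval p := mul_eval_pos_of_dominant f hp hDp
  have hψp : 0 < ψ p := by
    have hid := eval_eq_pow_mul_sum_zpow f u hp
    have hpu : 0 < p ^ u := pow_pos hp u
    -- `a_u a_w > 0` and `a_u f(p) > 0` give `a_w f(p) > 0`
    have h1 : 0 < f.coeff w * f.eval p := by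
      have hu0 : f.coeff u ≠ 0 := fun h => by rw [h, zero_mul] at hsign; exact lt_irrefl _ hsign
      have : 0 < (f.coeff u * f.coeff w) * (f.coeff u * f.eval p) := mul_pos hsign hfp
      have h2 : (f.coeff u * f.coeff w) * (f.coeff u * f.eval p) = (f.coeff u * f.coeff u) * (f.coeff w * f.eval p) := by
        ring
      rw [h2] at this
      exact pos_of_mul_pos_right this (mul_self_nonneg _)
    have h3 : p ^ u * ψ p = f.coeff w * f.eval p := by
      simp only [hψ]; rw [hid]; ring
    have h4 : 0 < p ^ u * ψ p := by rw [h3]; exact h1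
    exact pos_of_mul_pos_right h4 hpu.le
  intro hr
  have hy0 : 0 < y := lt_of_lt_of_le hp hy.1
  have hψy : ψ y = 0 := by
    rw [eval_eq_pow_mul_sum_zpow f u hy0] at hr
    rcases mul_eq_zero.mp hr with h | h
    · exact absurd h (pow_ne_zero _ hy0.ne')
    · simp only [hψ]; rw [h, mul_zero]
  have hle : ψ p ≤ ψ y := hmono.monotoneOn ⟨le_rfl, hpq⟩ hy hy.1
  linarith


/-! ## The lower half (intermediate value theorem) and the exact count -/

/-- **An alternating window carries a zero.** If `u` dominates at `p`, `w` dominates at `q` (`0 < p ≤ q`) and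
`a_u a_w < 0`, then `f` vanishes somewhere in `(p, q)`. [folklore] -/
theorem exists_root_of_alternating_window (f : ℝ[X]) {u w : ℕ} {p q : ℝ} (hp : 0 < p) (hpq : p ≤ q)
    (hDp : ∑ s ∈ f.support.erase u, |f.coeff s| * p ^ s < |f.coeff u| * p ^ u)
    (hDq : ∑ s ∈ f.support.erase w, |f.coeff s| * q ^ s < |f.coeff w| * q ^ w)
    (hsign : f.coeff u * f.coeff w < 0) : ∃ y ∈ Set.Ioo p q, f.eval y = 0 := by
  have hq : 0 < q := lt_of_lt_of_le hp hpq
  have h1 : 0 < f.coeff u * f.eval p := mul_eval_pos_of_dominant f hp hDp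
  have h2 : 0 < f.coeff w * f.eval q := mul_eval_pos_of_dominant f hq hDq
  -- `f(p) f(q) < 0`
  have h3 : f.eval p * f.eval q < 0 := by
    have h4 : 0 < (f.coeff u * f.eval p) * (f.coeff w * f.eval q) := mul_pos h1 h2
    have h5 : (f.coeff u * f.eval p) * (f.coeff w * f.eval q) = (f.coeff u * f.coeff w) * (f.eval p * f.eval q) := by ring
    rw [h5] at h4
    by_contra h6
    push Not at h6
    have := mul_nonpos_of_nonpos_of_nonneg hsign.le h6
    linarith
  have hcont : ContinuousOn (fun y => f.eval y) (Set.Icc p q) := f.continuous.continuousOn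
  rcases lt_or_gt_of_ne (show f.eval p ≠ 0 from fun h => by rw [h, zero_mul] at h3; exact lt_irrefl _ h3) with hfp | hfp
  · -- `f(p) < 0 < f(q)`
    have hfq : 0 < f.eval q := by nlinarith
    obtain ⟨y, hy, hy0⟩ := intermediate_value_Ioo hpq hcont ⟨hfp, hfq⟩
    exact ⟨y, hy, hy0⟩
  · have hfq : f.eval q < 0 := by nlinarith
    obtain ⟨y, hy, hy0⟩ := intermediate_value_Ioo' hpq hcont ⟨hfq, hfp⟩
    exact ⟨y, hy, hy0⟩

end Summit.ValiantsHypothesis.ValiantsHypothesis.Theorems.KPlusLogSqLaw.ExactPatchwork
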